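import Summits.AnomalousDissipation.AnomalousDissipation.Theorems.SolenoidalFractalHomogenisationLagrangianStepZ7GlueEulerDefs
import Summits.AnomalousDissipation.AnomalousDissipation.Theorems.SolenoidalFractalHomogenisationLagrangianStepVmodDistortedDefs
import HarnessLib

/-!
# K1L_D (stmt-AnomalousDissipation-27980): the EulerPiece Vmod text WITH AN EXTRA CLAUSE BINDER after the (V) line — generic `X` form and the (V_θ) instance
(Summits-side definitions file; review lane; prover lead-k1l-onelevel-p1 g6; tenure RULINGS D27-16 (2), D28-1 (1)/(3)/(4); certifier Q1 sign-off 2026-08-29T09:17:05Z.)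

RULING D28-1: the new cell-law input (V_θ) (`VmodDist.SlowVectorClauseFθ`, p711553) is THREADED as a SEPARATE BINDER with the SAME constants, inserted
IMMEDIATELY AFTER the (V) line `SlowVectorClauseF W M hM c Φ lo hi Λ β σ C ν₀ K →` in every consumer text; recommended GENERIC form: a clause-shaped
predicate `X W M hM c Φ lo hi Λ β σ C ν₀ K` so that the next new input threads with zero new glue.
* `Vmod_E_textHTX X e` — `Z7Glue.Vmod_E_textHT e` with the line `X W M hM c Φ lo hi Λ β σ C ν₀ K →` after its (V) line (conclusion UNCHANGED:
  `… SlowVectorClauseEulerPieceT … (e σ) Cm ν₀ K θ₁ ϱ₁`);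
* `Xθ` — the (V_θ) instance `fun W M hM c Φ lo hi Λ β σ C ν₀ K => ∃ θV > 0, VmodDist.SlowVectorClauseFθ W M hM c Φ lo hi Λ β σ C ν₀ K θV`;
* **`Vmod_E_textHTθ e`** — the v28 CANDIDATE Vmod text, written out EXPLICITLY (= `Vmod_E_textHTX Xθ e` by `Iff.rfl`, lemma `vmod_E_textHTθ_iff_X` in the glue file).
Glue: `…Z7GlueEulerX` (`cellInputs_BIL_ofEulerX X hX e he : Vmod_E_textHTX X e → cellInputs_alphaBeta_textP → §9zX`, `…ofEulerθ`).
Definitions only; NOT a proof of anything; K1L_D open; AD NOT proved; rung F-D1.A0.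
-/

set_option linter.dupNamespace false

noncomputable section

namespace Summit.AnomalousDissipation.AnomalousDissipation.Theorems.SolenoidalFractalHomogenisation.LagrangianStep.Z7Glue

open Literature.Analysis Literature.Analysis.FluidPDE Literature.Analysis.FunctionSpaces
open MeasureTheory Set
open scoped InnerProductSpace
open Literature.Analysis.FluidPDE.LatticeShear (LagrangianLatticeCarrier LatticeWord)
open Summit.AnomalousDissipation.AnomalousDissipation.Theorems.SolenoidalFractalHomogenisation.LagrangianStep.CellClauseMod

/-- **`Vmod_E_textHTX X e`**: the EulerPiece Vmod text `Vmod_E_textHT e` with an extra clause-shaped binder `X W M hM c Φ lo hi Λ β σ C ν₀ K →` inserted after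
the (V) line (RULING D28-1 (1)/(3), generic form). -/
def Vmod_E_textHTX (X : ∀ {k : ℕ}, LatticeWord k → (M : ℝ) → 0 < M → ℝ → (ℝ → Torus.Visc4 (Fin 3) → Torus.Visc4 (Fin 3)) → ℝ → ℝ → ℝ → ℝ → ℝ → ℝ → ℝ → ℝ → Prop) (e : ℝ → ℝ) : Prop :=
  ∀ k (W : LatticeWord k) (M : ℝ) (hM : 0 < M) (c : ℝ), 0 < c →
  ∀ (Φ : ℝ → Torus.Visc4 (Fin 3) → Torus.Visc4 (Fin 3)) (lo hi Λ β σ C ν₀ K : ℝ),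
    0 < lo → lo ≤ 1 → 1 ≤ hi → 1 < Λ → 0 ≤ β → 0 < σ → 0 ≤ C → 0 < ν₀ → ν₀ ≤ 1 → 0 < K →
    SlowVectorClauseF W M hM c Φ lo hi Λ β σ C ν₀ K →
    X W M hM c Φ lo hi Λ β σ C ν₀ K →
    (∀ Kb : ℝ, 1 ≤ Kb → ∃ CK : ℝ, 1 ≤ CK ∧ ∃ cK > (0:ℝ), ∃ νh > (0:ℝ), HighLabelDecayW W M hM lo hi Λ β νh Kb CK cK) →
    ∃ θ₁ > (0:ℝ), ∃ ϱ₁ > (0:ℝ), ∃ Cm : ℝ, C ≤ Cm ∧ SlowVectorClauseEulerPieceT W M hM c Φ lo hi Λ β (e σ) Cm ν₀ K θ₁ ϱ₁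

/-- **The (V_θ) binder `Xθ`** (RULING D28-1 (1), line of record): `∃ θV > 0, VmodDist.SlowVectorClauseFθ W M hM c Φ lo hi Λ β σ C ν₀ K θV`. -/
def Xθ {k : ℕ} (W : LatticeWord k) (M : ℝ) (hM : 0 < M) (c : ℝ) (Φ : ℝ → Torus.Visc4 (Fin 3) → Torus.Visc4 (Fin 3))
    (lo hi Λ β σ C ν₀ K : ℝ) : Prop :=
  ∃ θV > (0:ℝ), VmodDist.SlowVectorClauseFθ W M hM c Φ lo hi Λ β σ C ν₀ K θV

/-- **`Vmod_E_textHTθ e` — the v28 CANDIDATE Vmod text** (RULINGS D27-16 (2), D28-1 (4)): `Vmod_E_textHT e` with the (V_θ) family binder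
`(∃ θV > (0:ℝ), VmodDist.SlowVectorClauseFθ W M hM c Φ lo hi Λ β σ C ν₀ K θV) →` inserted immediately after the (V) line; conclusion unchanged. -/
def Vmod_E_textHTθ (e : ℝ → ℝ) : Prop :=
  ∀ k (W : LatticeWord k) (M : ℝ) (hM : 0 < M) (c : ℝ), 0 < c →
  ∀ (Φ : ℝ → Torus.Visc4 (Fin 3) → Torus.Visc4 (Fin 3)) (lo hi Λ β σ C ν₀ K : ℝ),
    0 < lo → lo ≤ 1 → 1 ≤ hi → 1 < Λ → 0 ≤ β → 0 < σ → 0 ≤ C → 0 < ν₀ → ν₀ ≤ 1 → 0 < K →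
    SlowVectorClauseF W M hM c Φ lo hi Λ β σ C ν₀ K →
    (∃ θV > (0:ℝ), VmodDist.SlowVectorClauseFθ W M hM c Φ lo hi Λ β σ C ν₀ K θV) →
    (∀ Kb : ℝ, 1 ≤ Kb → ∃ CK : ℝ, 1 ≤ CK ∧ ∃ cK > (0:ℝ), ∃ νh > (0:ℝ), HighLabelDecayW W M hM lo hi Λ β νh Kb CK cK) →
    ∃ θ₁ > (0:ℝ), ∃ ϱ₁ > (0:ℝ), ∃ Cm : ℝ, C ≤ Cm ∧ SlowVectorClauseEulerPieceT W M hM c Φ lo hi Λ β (e σ) Cm ν₀ K θ₁ ϱ₁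


/-! ## AMENDMENT 1 (RULING D28-3 (2)(b), 2026-08-29; prover lead-k1l-onelevel-p1 g6): the GRADED instance `Xθg` and the generic weakening certificate

FINDING F-p5g15-1 / RULING D28-3: `Xθ` above is UNSATISFIABLE on the design instance (`VmodDist.SlowVectorClauseFθ … θV` is false for every
`θV > 0`) and `Vmod_E_textHTθ` is UNUSED — both are DEAD VOCABULARY (never instantiate).  The (V_θ) binder of record is the GRADED clause
`VmodDist.SlowVectorClauseFθg` (…VmodDistortedDefs, amendment 2); v28's Vmod stub is stated BY NAME on the generic decl:
`stub_Vmod_EHTθg : Z7Glue.Vmod_E_textHTX Z7Glue.Xθg (fun σ => min (σ / 2) (1 / 2))` (no `Vmod_E_textHTθg` def, per D28-3 (2)(b)).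
NOT a proof of anything load-bearing; K1L_D open; AD NOT proved; rung F-D1.A0. -/

/-- **`Xθg` — the GRADED (V_θ) instance of the generic binder** (RULING D28-3): `∃ θV > 0, VmodDist.SlowVectorClauseFθg W M hM c Φ lo hi Λ β σ C ν₀ K θV`. -/
def Xθg {k : ℕ} (W : LatticeWord k) (M : ℝ) (hM : 0 < M) (c : ℝ) (Φ : ℝ → Torus.Visc4 (Fin 3) → Torus.Visc4 (Fin 3))
    (lo hi Λ β σ C ν₀ K : ℝ) : Prop :=
  ∃ θV > (0:ℝ), VmodDist.SlowVectorClauseFθg W M hM c Φ lo hi Λ β σ C ν₀ K θV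

/-- `Xθg` is antitone in the threshold `ν₀` — exactly the `hX` hypothesis of `cellInputs_BIL_ofEulerX` at `X := Xθg`. [folklore] -/
theorem Xθg_mono_ν₀ {k : ℕ} (W : LatticeWord k) (M : ℝ) (hM : 0 < M) (c : ℝ) (Φ : ℝ → Torus.Visc4 (Fin 3) → Torus.Visc4 (Fin 3))
    (lo hi Λ β σ C ν₀ ν₀' K : ℝ) (hle : ν₀' ≤ ν₀) (h : Xθg W M hM c Φ lo hi Λ β σ C ν₀ K) :
    Xθg W M hM c Φ lo hi Λ β σ C ν₀' K := by
  obtain ⟨θV, hθV, hF⟩ := h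
  exact ⟨θV, hθV, hF.mono_ν₀ hle⟩

/-- **Generic weakening certificate** (RULING D28-3 (2)(b); v28's superseded-by-weaker certificate): the binder-free text implies the text
with ANY extra binder `X` (the extra hypothesis is simply dropped). [folklore] -/
theorem vmod_E_textHTX_of_textHT
    (X : ∀ {k : ℕ}, LatticeWord k → (M : ℝ) → 0 < M → ℝ → (ℝ → Torus.Visc4 (Fin 3) → Torus.Visc4 (Fin 3)) → ℝ → ℝ → ℝ → ℝ → ℝ → ℝ → ℝ → ℝ → Prop)
    (e : ℝ → ℝ) (h : Vmod_E_textHT e) : Vmod_E_textHTX X e := by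
  intro k W M hM c hc Φ lo hi Λ β σ C ν₀ K hlo hlo1 hhi hΛ hβ hσ hC hν₀ hν₀1 hK hV _hX hH
  exact h k W M hM c hc Φ lo hi Λ β σ C ν₀ K hlo hlo1 hhi hΛ hβ hσ hC hν₀ hν₀1 hK hV hH

end Summit.AnomalousDissipation.AnomalousDissipation.Theorems.SolenoidalFractalHomogenisation.LagrangianStep.Z7Glue

end
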